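import Summits.AtomisticToContinuum.Crystallization.Theorems.ChessboardParticlePlanesPeriodicWindowsOffsetPrismEnergy
import Summits.AtomisticToContinuum.Crystallization.Theorems.ChessboardParticlePlanesPeriodicWindowsOffsetLayerSymmetry
import Summits.AtomisticToContinuum.Crystallization.Theorems.ChessboardParticlePlanesPeriodicWindowsHcLayerSumMono
import Summits.AtomisticToContinuum.Crystallization.Theorems.ChessboardParticlePlanesPeriodicWindowsHcLayerSumSymm
import Summits.AtomisticToContinuum.Crystallization.Theorems.ChessboardParticlePlanesPeriodicWindowsHcCompressedHeights
import Summits.AtomisticToContinuum.Crystallization.Theorems.ChessboardParticlePlanesPeriodicWindowsHcFarPair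
import Summits.AtomisticToContinuum.Crystallization.Theorems.ChessboardParticlePlanesPeriodicWindowsHcBlockSum

/-!
# Crux `PeriodicWindows` (stmt-AtomisticToContinuum-3240), line `dense-laminar-hull` — C6 `hc_competitor`: the block energy inequality of
# the COMBINED competitor of HC `stub_hollowClosing` (lead c12; numerics-free, parametric in the certificate constants)

Let `S = B '' {i v₁(a) + j v₂(a) + δ m + z m e₃}` be a general layered set (`a ≥ 7/10`, horizontal offsets, gaps in `[3/4, 1]`)
and let the COMBINED COMPETITOR `S'` have offsets `δ'` whose consecutive differences are the hollow vectors `w m ∈ {±b} + Λ` up to the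
lattice and `t`-compressed heights `z'` (increments `min(gap, t)`, `t ≥ 3/4`). Under the PARAMETRIC certificate hypotheses
* (E1★, per interface) `κ ‖θ_m − w_m‖² + μ (g_m − t)₊² ≤ Φ(a, g_m, θ_m) − Φ(a, min(g_m, t), w_m)`, `‖θ_m − w_m‖ ≤ a`;
* (E2, per layer distance `k ≥ 2`) `|Φ(a,H,w+ξ) − Φ(a,H,w)| ≤ h_k ‖ξ‖²` for `|H| ≥ 3k/4`, `w ∈ {0, ±b}`, `‖ξ‖ ≤ 2a`, horizontal `ξ`,
  with `h_k ≥ 0`, `Σ_k 2k² h_k ≤ κ`, `Σ_k k³ h_k ≤ c_B`,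
the site-energy sums over every index box `[m₁, m₁+n) × [0, K)²` satisfy
`E(box; S) − E(box; S') ≥ K² (Σ_{m∈[m₁,m₁+n)} (κ ‖θ_m − w_m‖² + μ (g_m − t)₊²) − (2c_B + 2κ) a²)` (`hc_competitor`).
Proof: energies layer by layer (`gs_prismEnergy`, LC-C; summability from LC-A/LC-B), pair differences `D(m,m')` bounded by E1★ for
adjacent pairs (both orientations through `Φ(−H, −θ) = Φ(H, θ)`, `hc_layerSum_symm`) and by `hc_farPair` for `|m − m'| ≥ 2`
(compression only helps; lattice reduction; E2 at the window sums `Σ w_i ∈ {0, ±b} + Λ` — `hcC_class_sum`, using `3b = v₁ + v₂`;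
`‖Σ (θ_i − w_i)‖² ≤ k Σ ‖θ_i − w_i‖²`), summed by the abstract block summation `hc_blockSum`. Numerics-free. [folklore]
-/

noncomputable section

namespace Summit.AtomisticToContinuum.Crystallization.Theorems.PeriodicWindowsDenseLaminarHull

open Literature.MathematicalPhysics.StatisticalMechanics Filter Metric
open scoped BigOperators

/-! ## Small helpers -/

/-- `Φ(a, −H, −θ) = Φ(a, H, θ)` for a horizontal offset (inversion symmetry; from `hc_layerSum_symm`). [folklore] -/
theorem hcC_negneg (a H : ℝ) (θ : EuclideanSpace ℝ (Fin 3)) (hθ : θ 2 = 0) :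
    (∑' ij : ℤ × ℤ, lennardJones ‖((ij.1 : ℝ)) • triangularVec₁ a + ((ij.2 : ℝ)) • triangularVec₂ a + (-θ) +
        (-H) • layerNormal 1‖) =
      ∑' ij : ℤ × ℤ, lennardJones ‖((ij.1 : ℝ)) • triangularVec₁ a + ((ij.2 : ℝ)) • triangularVec₂ a + θ + H • layerNormal 1‖ := by
  have hθ' : (-θ) 2 = 0 := by rw [PiLp.neg_apply, hθ, neg_zero]
  obtain ⟨h1, -, -⟩ := hc_layerSum_symm lennardJones a H (-θ) hθ'
  obtain ⟨-, h2, -⟩ := hc_layerSum_symm lennardJones a H θ hθ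
  rw [h1, h2]

/-- The hollow vector and the layer lattice: `3 b = v₁ + v₂`. [folklore] -/
theorem hcC_three_barlowOffset (a : ℝ) : (3 : ℝ) • barlowOffset a = triangularVec₁ a + triangularVec₂ a := by
  ext i
  fin_cases i <;> simp [barlowOffset, triangularVec₁, triangularVec₂] <;> ring

/-- A symmetric-class vector `s b + i v₁ + j v₂` is horizontal. [folklore] -/
theorem hcC_class_two (a : ℝ) (s i j : ℝ) :
    (s • barlowOffset a + i • triangularVec₁ a + j • triangularVec₂ a) 2 = 0 := by
  rw [PiLp.add_apply, PiLp.add_apply, PiLp.smul_apply, PiLp.smul_apply, PiLp.smul_apply, hcf_barlowOffset_two,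
    gsc_triangularVec₁_two, gsc_triangularVec₂_two]
  simp

/-- **Sums of hollow vectors lie in a symmetric class**: if every `w m ∈ {±b} + ℤv₁ + ℤv₂`, then every window sum
`Σ_{l<k} w (m+l)` is `s b + i v₁ + j v₂` with `s ∈ {0, 1, −1}` (reduce with `3b = v₁ + v₂`). [folklore] -/
theorem hcC_class_sum {a : ℝ} {w : ℤ → EuclideanSpace ℝ (Fin 3)}
    (hw : ∀ m : ℤ, ∃ s i j : ℤ, (s = 1 ∨ s = -1) ∧
      w m = (s : ℝ) • barlowOffset a + (i : ℝ) • triangularVec₁ a + (j : ℝ) • triangularVec₂ a) (m : ℤ) (k : ℕ) :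
    ∃ s i j : ℤ, (s = 0 ∨ s = 1 ∨ s = -1) ∧ ∑ l ∈ Finset.range k, w (m + l) =
      (s : ℝ) • barlowOffset a + (i : ℝ) • triangularVec₁ a + (j : ℝ) • triangularVec₂ a := by
  have h3 := hcC_three_barlowOffset a
  induction k with
  | zero => exact ⟨0, 0, 0, Or.inl rfl, by simp⟩
  | succ k ih =>
    obtain ⟨s, i, j, hs, hsum⟩ := ih
    obtain ⟨s', i', j', hs', hw'⟩ := hw (m + k)
    rw [Finset.sum_range_succ, hsum, hw']
    -- the raw sum has letter `s + s'` ∈ {-2,…,2}; reduce modulo `3b = v₁ + v₂`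
    have key : ∀ (σ : ℤ) (c : ℤ), (σ : ℝ) • barlowOffset a + (i : ℝ) • triangularVec₁ a + (j : ℝ) • triangularVec₂ a +
        ((s' : ℝ) • barlowOffset a + (i' : ℝ) • triangularVec₁ a + (j' : ℝ) • triangularVec₂ a) =
        ((σ + s' - 3 * c : ℤ) : ℝ) • barlowOffset a + ((i + i' + c : ℤ) : ℝ) • triangularVec₁ a +
          ((j + j' + c : ℤ) : ℝ) • triangularVec₂ a := by
      intro σ c
      have e : ((σ + s' - 3 * c : ℤ) : ℝ) • barlowOffset a =
          ((σ + s' : ℤ) : ℝ) • barlowOffset a - ((c : ℤ) : ℝ) • (triangularVec₁ a + triangularVec₂ a) := by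
        rw [← h3, smul_smul]; push_cast; module
      rw [e]; push_cast; module
    rcases hs with rfl | rfl | rfl <;> rcases hs' with rfl | rfl
    · exact ⟨1, i + i' + 0, j + j' + 0, Or.inr (Or.inl rfl), by rw [key 0 0]; norm_num⟩
    · exact ⟨-1, i + i' + 0, j + j' + 0, Or.inr (Or.inr rfl), by rw [key 0 0]; norm_num⟩
    · exact ⟨-1, i + i' + 1, j + j' + 1, Or.inr (Or.inr rfl), by rw [key 1 1]; norm_num⟩
    · exact ⟨0, i + i' + 0, j + j' + 0, Or.inl rfl, by rw [key 1 0]; norm_num⟩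
    · exact ⟨0, i + i' + 0, j + j' + 0, Or.inl rfl, by rw [key (-1) 0]; norm_num⟩
    · exact ⟨1, i + i' + (-1), j + j' + (-1), Or.inr (Or.inl rfl), by rw [key (-1) (-1)]; norm_num⟩

/-- **Telescoping of the competitor offsets**: if `δ' (m+1) - δ' m = w m` up to the lattice, then
`δ' (m+k) - δ' m = Σ_{l<k} w (m+l)` up to the lattice. [folklore] -/
theorem hcC_tele {a : ℝ} {δ' w : ℤ → EuclideanSpace ℝ (Fin 3)}
    (hδ'w : ∀ m : ℤ, ∃ i j : ℤ, δ' (m + 1) - δ' m = w m + (i : ℝ) • triangularVec₁ a + (j : ℝ) • triangularVec₂ a)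
    (m : ℤ) (k : ℕ) : ∃ i j : ℤ, δ' (m + k) - δ' m =
      ∑ l ∈ Finset.range k, w (m + l) + ((i : ℝ) • triangularVec₁ a + (j : ℝ) • triangularVec₂ a) := by
  induction k with
  | zero => exact ⟨0, 0, by simp⟩
  | succ k ih =>
    obtain ⟨i, j, hij⟩ := ih
    obtain ⟨i', j', hij'⟩ := hδ'w (m + k)
    refine ⟨i + i', j + j', ?_⟩
    have e : δ' (m + ((k + 1 : ℕ) : ℤ)) - δ' m = (δ' (m + k) - δ' m) + (δ' (m + k + 1) - δ' (m + k)) := by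
      push_cast; rw [← add_assoc]; abel
    rw [e, hij, hij', Finset.sum_range_succ]
    push_cast
    module

/-- Telescoping of the original offsets: `δ (m+k) - δ m = Σ_{l<k} (δ (m+l+1) - δ (m+l))`. [folklore] -/
theorem hcC_tele' (δ : ℤ → EuclideanSpace ℝ (Fin 3)) (m : ℤ) (k : ℕ) :
    δ (m + k) - δ m = ∑ l ∈ Finset.range k, (δ (m + l + 1) - δ (m + l)) := by
  have h := Finset.sum_range_sub (fun l : ℕ => δ (m + l)) k
  simp only [Nat.cast_add, Nat.cast_one, ← add_assoc] at h
  rw [h]; simp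

/-- `‖Σ_{l<k} x l‖² ≤ k Σ_{l<k} ‖x l‖²`. [folklore] -/
theorem hcC_norm_sum_sq (x : ℕ → EuclideanSpace ℝ (Fin 3)) (k : ℕ) :
    ‖∑ l ∈ Finset.range k, x l‖ ^ 2 ≤ k * ∑ l ∈ Finset.range k, ‖x l‖ ^ 2 := by
  calc ‖∑ l ∈ Finset.range k, x l‖ ^ 2 ≤ (∑ l ∈ Finset.range k, ‖x l‖) ^ 2 :=
        pow_le_pow_left₀ (norm_nonneg _) (norm_sum_le _ _) 2
    _ ≤ (Finset.range k).card * ∑ l ∈ Finset.range k, ‖x l‖ ^ 2 := sq_sum_le_card_mul_sum_sq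
    _ = k * ∑ l ∈ Finset.range k, ‖x l‖ ^ 2 := by rw [Finset.card_range]

/-- A horizontal vector shifted by a lattice vector is horizontal. [folklore] -/
theorem hcC_shift_two {a : ℝ} {θ : EuclideanSpace ℝ (Fin 3)} (hθ : θ 2 = 0) (i j : ℝ) :
    (θ + i • triangularVec₁ a + j • triangularVec₂ a) 2 = 0 := by
  rw [PiLp.add_apply, PiLp.add_apply, PiLp.smul_apply, PiLp.smul_apply, hθ, gsc_triangularVec₁_two,
    gsc_triangularVec₂_two]
  simp

/-- An integer interval sum as a range sum: `Σ_{i ∈ [m, m+k)} f i = Σ_{l<k} f (m+l)`. [folklore] -/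
theorem hcC_sum_Ico_range (f : ℤ → ℝ) (m : ℤ) (k : ℕ) :
    ∑ i ∈ Finset.Ico m (m + k), f i = ∑ l ∈ Finset.range k, f (m + l) := by
  induction k with
  | zero => simp
  | succ k ih =>
    rw [Finset.sum_range_succ, ← ih]
    have hs : Finset.Ico (m + k) (m + k + 1) = {m + (k : ℤ)} := by
      ext x; simp only [Finset.mem_Ico, Finset.mem_singleton]; omega
    rw [show (m + ((k + 1 : ℕ) : ℤ)) = m + k + 1 by push_cast; ring,
      ← Finset.Ico_union_Ico_eq_Ico (by omega : m ≤ m + k) (by omega : m + (k : ℤ) ≤ m + k + 1),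
      Finset.sum_union (Finset.Ico_disjoint_Ico_consecutive _ _ _), hs, Finset.sum_singleton]

/-! ## The competitor inequality -/

/-- **C6 `hc_competitor` — the block energy inequality of the COMBINED competitor** (numerics-free, parametric in the certificate
constants). Let `S = B '' {i v₁(a) + j v₂(a) + δ m + z m e₃}` be a general layered set (`a ≥ 7/10`, gaps in `[3/4, 1]`) and let the
competitor `S'` have offsets `δ'` whose consecutive differences are hollow vectors `w m` up to the lattice and `t`-compressed heights
`z'` (`t ≥ 3/4`). Suppose (E1★, per interface) `κ ‖θ_m − w_m‖² + μ (g_m − t)₊² ≤ Φ(a, g_m, θ_m) − Φ(a, min(g_m,t), w_m)` with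
`‖θ_m − w_m‖ ≤ a`, and (E2, per layer distance `k ≥ 2`) `|Φ(a,H,w+ξ) − Φ(a,H,w)| ≤ h_k ‖ξ‖²` for `|H| ≥ 3k/4`, `w ∈ {0, ±b}`,
`‖ξ‖ ≤ 2a`, with `Σ 2k² h_k ≤ κ`, `Σ k³ h_k ≤ c_B`. Then for every prism index box `[m₁, m₁+n) × [0,K)²` the site-energy sums satisfy
`E(box; S) − E(box; S') ≥ K² (Σ_{m ∈ [m₁,m₁+n)} (κ‖θ_m − w_m‖² + μ(g_m − t)₊²) − (2c_B + 2κ) a²)`: energies layer by layer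
(`gs_prismEnergy`), pair differences bounded by E1★ (adjacent; both orientations by `Φ(−H,−θ) = Φ(H,θ)`) and by `hc_farPair`
(layer distance `≥ 2`: compression only helps, lattice reduction, E2 at the symmetric window sums `Σ w ∈ {0,±b} + Λ`,
`‖Σ(θ_i − w_i)‖² ≤ k Σ‖θ_i − w_i‖²`), summed by `hc_blockSum`. [folklore] -/
theorem hc_competitor : ∀ (a t κ μ cB : ℝ) (h : ℕ → ℝ), (7 : ℝ) / 10 ≤ a → (3 : ℝ) / 4 ≤ t → 0 ≤ κ → 0 ≤ μ → 0 ≤ cB →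
    (∀ k, 0 ≤ h k) → (∀ K : ℕ, ∑ k ∈ Finset.Icc 2 K, 2 * (k : ℝ) ^ 2 * h k ≤ κ) →
    (∀ K : ℕ, ∑ k ∈ Finset.Icc 2 K, (k : ℝ) ^ 3 * h k ≤ cB) →
    (∀ (k : ℕ) (H : ℝ), 2 ≤ k → (3 : ℝ) / 4 * k ≤ |H| → ∀ (w ξ : EuclideanSpace ℝ (Fin 3)),
      (w = 0 ∨ w = barlowOffset a ∨ w = -barlowOffset a) → ξ 2 = 0 → ‖ξ‖ ≤ 2 * a →
      |(∑' ij : ℤ × ℤ, lennardJones ‖((ij.1 : ℝ)) • triangularVec₁ a + ((ij.2 : ℝ)) • triangularVec₂ a + (w + ξ) +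
          H • layerNormal 1‖) -
        (∑' ij : ℤ × ℤ, lennardJones ‖((ij.1 : ℝ)) • triangularVec₁ a + ((ij.2 : ℝ)) • triangularVec₂ a + w +
          H • layerNormal 1‖)| ≤ h k * ‖ξ‖ ^ 2) →
    ∀ (B : EuclideanSpace ℝ (Fin 3) ≃ₗᵢ[ℝ] EuclideanSpace ℝ (Fin 3)) (δ δ' w : ℤ → EuclideanSpace ℝ (Fin 3)) (z z' : ℤ → ℝ),
    (∀ p : EuclideanSpace ℝ (Fin 3), (B p) 2 = p 2) → (∀ m : ℤ, (δ m) 2 = 0) → (∀ m : ℤ, (δ' m) 2 = 0) →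
    StrictMono z → (∀ m : ℤ, (3 : ℝ) / 4 ≤ z (m + 1) - z m) → (∀ m : ℤ, z (m + 1) - z m ≤ 1) →
    (∀ m : ℤ, z' (m + 1) - z' m = min (z (m + 1) - z m) t) →
    (∀ m : ℤ, ∃ s i j : ℤ, (s = 1 ∨ s = -1) ∧
      w m = (s : ℝ) • barlowOffset a + (i : ℝ) • triangularVec₁ a + (j : ℝ) • triangularVec₂ a) →
    (∀ m : ℤ, ∃ i j : ℤ, δ' (m + 1) - δ' m = w m + (i : ℝ) • triangularVec₁ a + (j : ℝ) • triangularVec₂ a) →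
    (∀ m : ℤ, ‖(δ (m + 1) - δ m) - w m‖ ≤ a) →
    (∀ m : ℤ, κ * ‖(δ (m + 1) - δ m) - w m‖ ^ 2 + μ * (max (z (m + 1) - z m - t) 0) ^ 2 ≤
      (∑' ij : ℤ × ℤ, lennardJones ‖((ij.1 : ℝ)) • triangularVec₁ a + ((ij.2 : ℝ)) • triangularVec₂ a +
          (δ (m + 1) - δ m) + (z (m + 1) - z m) • layerNormal 1‖) -
      (∑' ij : ℤ × ℤ, lennardJones ‖((ij.1 : ℝ)) • triangularVec₁ a + ((ij.2 : ℝ)) • triangularVec₂ a +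
          w m + (z' (m + 1) - z' m) • layerNormal 1‖)) →
    ∀ (m₁ : ℤ) (n K : ℕ),
    (K : ℝ) ^ 2 * ((∑ m ∈ Finset.Ico m₁ (m₁ + n),
        (κ * ‖(δ (m + 1) - δ m) - w m‖ ^ 2 + μ * (max (z (m + 1) - z m - t) 0) ^ 2)) - (2 * cB + 2 * κ) * a ^ 2) ≤
      (∑ t ∈ (Finset.Ico m₁ (m₁ + n)) ×ˢ ((Finset.range K) ×ˢ (Finset.range K)),
        (∑' q : {q : EuclideanSpace ℝ (Fin 3) // q ∈ (fun p => B p) '' {p | ∃ m i j : ℤ, p = ((i : ℝ) • triangularVec₁ a) +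
            ((j : ℝ) • triangularVec₂ a) + δ m + (z m • layerNormal 1)} ∧ q ≠ B (((t.2.1 : ℝ) • triangularVec₁ a) +
            ((t.2.2 : ℝ) • triangularVec₂ a) + δ t.1 + (z t.1 • layerNormal 1))},
          lennardJones (dist (B (((t.2.1 : ℝ) • triangularVec₁ a) + ((t.2.2 : ℝ) • triangularVec₂ a) + δ t.1 +
            (z t.1 • layerNormal 1))) (q : EuclideanSpace ℝ (Fin 3))))) -
      (∑ t ∈ (Finset.Ico m₁ (m₁ + n)) ×ˢ ((Finset.range K) ×ˢ (Finset.range K)),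
        (∑' q : {q : EuclideanSpace ℝ (Fin 3) // q ∈ (fun p => B p) '' {p | ∃ m i j : ℤ, p = ((i : ℝ) • triangularVec₁ a) +
            ((j : ℝ) • triangularVec₂ a) + δ' m + (z' m • layerNormal 1)} ∧ q ≠ B (((t.2.1 : ℝ) • triangularVec₁ a) +
            ((t.2.2 : ℝ) • triangularVec₂ a) + δ' t.1 + (z' t.1 • layerNormal 1))},
          lennardJones (dist (B (((t.2.1 : ℝ) • triangularVec₁ a) + ((t.2.2 : ℝ) • triangularVec₂ a) + δ' t.1 +
            (z' t.1 • layerNormal 1))) (q : EuclideanSpace ℝ (Fin 3))))) := by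
  intro a t κ μ cB h ha ht hκ hμ hcB hh hsmall hbdry hE2 B δ δ' w z z' hB hδ hδ' hz hgap hgap1 hz' hw hδ'w hda hE1 m₁ n K
  have ha0 : 0 < a := by linarith
  -- the compressed heights
  have hgap' : ∀ m : ℤ, (3 : ℝ) / 4 ≤ z' (m + 1) - z' m := fun m => by rw [hz' m]; exact le_min (hgap m) ht
  have hz'mono : StrictMono z' := strictMono_int_of_lt_succ fun m => by linarith [hgap' m]
  -- energies layer by layer (LC-C) and the analytic inputs (LC-B, LC-A)
  obtain ⟨hin, C, hC⟩ := stub_offsetLayerDecay a ha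
  have hLC := fun m i j => stub_offsetLayerCake a ha B δ z hB hδ hz hgap hin ⟨C, hC⟩ m i j
  have hLC' := fun m i j => stub_offsetLayerCake a ha B δ' z' hB hδ' hz'mono hgap' hin ⟨C, hC⟩ m i j
  rw [gs_prismEnergy a ha B δ z hB hδ hz hgap m₁ n K, gs_prismEnergy a ha B δ' z' hB hδ' hz'mono hgap' m₁ n K, ← mul_sub,
    ← Finset.sum_sub_distrib]
  refine mul_le_mul_of_nonneg_left ?_ (sq_nonneg _)
  -- the pair differences
  set F : ℤ → ℤ → ℝ := fun m m' => if m' = m then (0 : ℝ) else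
    ∑' ij : ℤ × ℤ, lennardJones ‖((ij.1 : ℝ)) • triangularVec₁ a + ((ij.2 : ℝ)) • triangularVec₂ a +
      (δ m' - δ m) + (z m' - z m) • layerNormal 1‖ with hF
  set F' : ℤ → ℤ → ℝ := fun m m' => if m' = m then (0 : ℝ) else
    ∑' ij : ℤ × ℤ, lennardJones ‖((ij.1 : ℝ)) • triangularVec₁ a + ((ij.2 : ℝ)) • triangularVec₂ a +
      (δ' m' - δ' m) + (z' m' - z' m) • layerNormal 1‖ with hF'
  have hsumF : ∀ m, Summable (F m) := fun m => (hLC m 0 0).1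
  have hsumF' : ∀ m, Summable (F' m) := fun m => (hLC' m 0 0).1
  set D : ℤ → ℤ → ℝ := fun m m' => F m m' - F' m m' with hD
  have hsumD : ∀ m, Summable (D m) := fun m => (hsumF m).sub (hsumF' m)
  have hsplit : ∀ m ∈ Finset.Ico m₁ (m₁ + n),
      (inLayerInteraction lennardJones a + ∑' m' : ℤ, F m m') - (inLayerInteraction lennardJones a + ∑' m' : ℤ, F' m m') =
        ∑' m' : ℤ, D m m' := fun m _ => by
    rw [hD, (hsumF m).tsum_sub (hsumF' m)]; ring
  rw [Finset.sum_congr rfl hsplit]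
  -- the data of `hc_blockSum`
  set d : ℤ → ℝ := fun m => ‖(δ (m + 1) - δ m) - w m‖ with hd
  set b : ℤ → ℝ := fun m => μ * (max (z (m + 1) - z m - t) 0) ^ 2 with hb
  have hdb : ∀ i, 0 ≤ d i ∧ d i ≤ a := fun i => ⟨norm_nonneg _, hda i⟩
  have hb0 : ∀ i, 0 ≤ b i := fun i => by rw [hb]; positivity
  have hdiag : ∀ m, D m m = 0 := fun m => by simp [hD, hF, hF']
  -- horizontality facts
  have hθ2 : ∀ m m' : ℤ, (δ m' - δ m) 2 = 0 := fun m m' => by rw [PiLp.sub_apply, hδ, hδ, sub_zero]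
  have hθ'2 : ∀ m m' : ℤ, (δ' m' - δ' m) 2 = 0 := fun m m' => by rw [PiLp.sub_apply, hδ', hδ', sub_zero]
  have hw2 : ∀ m : ℤ, (w m) 2 = 0 := fun m => by
    obtain ⟨s, i, j, -, hwm⟩ := hw m
    rw [hwm]; exact hcC_class_two a _ _ _
  -- (adj) both orientations, through E1★
  have hadj1 : ∀ m : ℤ, κ * d m ^ 2 + b m ≤ D m (m + 1) := by
    intro m
    obtain ⟨i, j, hij⟩ := hδ'w m
    have hne : m + 1 ≠ m := by omega
    have e1 : F m (m + 1) = ∑' ij : ℤ × ℤ, lennardJones ‖((ij.1 : ℝ)) • triangularVec₁ a + ((ij.2 : ℝ)) • triangularVec₂ a +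
        (δ (m + 1) - δ m) + (z (m + 1) - z m) • layerNormal 1‖ := by simp [hF, hne]
    have e2 : F' m (m + 1) = ∑' ij : ℤ × ℤ, lennardJones ‖((ij.1 : ℝ)) • triangularVec₁ a + ((ij.2 : ℝ)) • triangularVec₂ a +
        w m + (z' (m + 1) - z' m) • layerNormal 1‖ := by
      simp only [hF', hne, if_false]
      rw [hij, add_assoc (w m), gs_offsetLayer_translate]
    show κ * d m ^ 2 + b m ≤ F m (m + 1) - F' m (m + 1)
    rw [e1, e2]
    exact hE1 m
  have hadj2 : ∀ m : ℤ, κ * d m ^ 2 + b m ≤ D (m + 1) m := by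
    intro m
    obtain ⟨i, j, hij⟩ := hδ'w m
    have hne : m ≠ m + 1 := by omega
    have e1 : F (m + 1) m = ∑' ij : ℤ × ℤ, lennardJones ‖((ij.1 : ℝ)) • triangularVec₁ a + ((ij.2 : ℝ)) • triangularVec₂ a +
        (δ (m + 1) - δ m) + (z (m + 1) - z m) • layerNormal 1‖ := by
      simp only [hF, hne, if_false]
      rw [← neg_sub (δ (m + 1)) (δ m), ← neg_sub (z (m + 1)) (z m), hcC_negneg a _ _ (hθ2 m (m + 1))]
    have e2 : F' (m + 1) m = ∑' ij : ℤ × ℤ, lennardJones ‖((ij.1 : ℝ)) • triangularVec₁ a + ((ij.2 : ℝ)) • triangularVec₂ a +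
        w m + (z' (m + 1) - z' m) • layerNormal 1‖ := by
      simp only [hF', hne, if_false]
      rw [← neg_sub (δ' (m + 1)) (δ' m), ← neg_sub (z' (m + 1)) (z' m), hij,
        hcC_negneg a _ _ (hcC_shift_two (hw2 m) _ _), add_assoc (w m), gs_offsetLayer_translate]
    show κ * d m ^ 2 + b m ≤ F (m + 1) m - F' (m + 1) m
    rw [e1, e2]
    exact hE1 m
  -- (far) layer distance `k ≥ 2`
  have hcs : ∀ (m : ℤ) (k : ℕ), ‖(δ (m + k) - δ m) - ∑ l ∈ Finset.range k, w (m + l)‖ ^ 2 ≤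
      k * ∑ i ∈ Finset.Ico m (m + k), d i ^ 2 := by
    intro m k
    have e : (δ (m + k) - δ m) - ∑ l ∈ Finset.range k, w (m + l) =
        ∑ l ∈ Finset.range k, ((δ (m + l + 1) - δ (m + l)) - w (m + l)) := by
      rw [hcC_tele' δ m k, ← Finset.sum_sub_distrib]
    rw [e, hcC_sum_Ico_range (fun i => d i ^ 2) m k]
    refine (hcC_norm_sum_sq _ k).trans (le_of_eq ?_)
    congr 1
  have hfar : ∀ (m : ℤ) (k : ℕ), 2 ≤ k →
      -(h k * k * ∑ i ∈ Finset.Ico m (m + k), d i ^ 2) ≤ D m (m + k) ∧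
      -(h k * k * ∑ i ∈ Finset.Ico m (m + k), d i ^ 2) ≤ D (m + k) m := by
    intro m k hk
    obtain ⟨hle, hge⟩ := hch_block z z' t ht hgap hz' m k
    have hk' : (2 : ℝ) ≤ k := by exact_mod_cast hk
    have hH'0 : 0 ≤ z' (m + k) - z' m := by nlinarith
    have hH' : (3 : ℝ) / 4 * k ≤ |z' (m + k) - z' m| := by rwa [abs_of_nonneg hH'0]
    have h1H' : 1 ≤ |z' (m + k) - z' m| := le_trans (by linarith) hH'
    have hHH' : |z' (m + k) - z' m| ≤ |z (m + k) - z m| := by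
      rw [abs_of_nonneg hH'0, abs_of_nonneg (hH'0.trans hle)]; exact hle
    obtain ⟨i, j, hij⟩ := hcC_tele hδ'w m k
    obtain ⟨s, i', j', hs, hW⟩ := hcC_class_sum hw m k
    have hne : m + k ≠ m := by omega
    have hne' : m ≠ m + k := by omega
    -- the far-pair bound at this pair
    have hfp := hc_farPair a ha (z (m + k) - z m) (z' (m + k) - z' m) (h k) (hh k) h1H' hHH'
      (hE2 k _ hk hH') (δ (m + k) - δ m) (∑ l ∈ Finset.range k, w (m + l)) (hθ2 m (m + k)) ⟨s, i', j', hs, hW⟩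
    have hbd : -(h k * k * ∑ i ∈ Finset.Ico m (m + k), d i ^ 2) ≤
        -(h k * ‖(δ (m + k) - δ m) - ∑ l ∈ Finset.range k, w (m + l)‖ ^ 2) := by
      have := mul_le_mul_of_nonneg_left (hcs m k) (hh k)
      linarith
    have hW2 : (∑ l ∈ Finset.range k, w (m + l)) 2 = 0 := by rw [hW]; exact hcC_class_two a _ _ _
    -- orientation `(m, m+k)`
    have e1 : F m (m + k) = ∑' ij : ℤ × ℤ, lennardJones ‖((ij.1 : ℝ)) • triangularVec₁ a + ((ij.2 : ℝ)) • triangularVec₂ a +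
        (δ (m + k) - δ m) + (z (m + k) - z m) • layerNormal 1‖ := by simp [hF, hne]
    have e2 : F' m (m + k) = ∑' ij : ℤ × ℤ, lennardJones ‖((ij.1 : ℝ)) • triangularVec₁ a + ((ij.2 : ℝ)) • triangularVec₂ a +
        (∑ l ∈ Finset.range k, w (m + l)) + (z' (m + k) - z' m) • layerNormal 1‖ := by
      simp only [hF', hne, if_false]
      rw [hij, gs_offsetLayer_translate]
    -- orientation `(m+k, m)`
    have e3 : F (m + k) m = ∑' ij : ℤ × ℤ, lennardJones ‖((ij.1 : ℝ)) • triangularVec₁ a + ((ij.2 : ℝ)) • triangularVec₂ a +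
        (δ (m + k) - δ m) + (z (m + k) - z m) • layerNormal 1‖ := by
      simp only [hF, hne', if_false]
      rw [← neg_sub (δ (m + k)) (δ m), ← neg_sub (z (m + k)) (z m), hcC_negneg a _ _ (hθ2 m (m + k))]
    have e4 : F' (m + k) m = ∑' ij : ℤ × ℤ, lennardJones ‖((ij.1 : ℝ)) • triangularVec₁ a + ((ij.2 : ℝ)) • triangularVec₂ a +
        (∑ l ∈ Finset.range k, w (m + l)) + (z' (m + k) - z' m) • layerNormal 1‖ := by
      simp only [hF', hne', if_false]
      rw [← neg_sub (δ' (m + k)) (δ' m), ← neg_sub (z' (m + k)) (z' m), hij,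
        hcC_negneg a _ _ (by
          rw [PiLp.add_apply, PiLp.add_apply, PiLp.smul_apply, PiLp.smul_apply, hW2, gsc_triangularVec₁_two,
            gsc_triangularVec₂_two]; simp),
        gs_offsetLayer_translate]
    refine ⟨hbd.trans ?_, hbd.trans ?_⟩
    · show _ ≤ F m (m + k) - F' m (m + k)
      rw [e1, e2]; exact hfp
    · show _ ≤ F (m + k) m - F' (m + k) m
      rw [e3, e4]; exact hfp
  -- the block summation
  have hmain := hc_blockSum κ cB a d b h D hκ hcB hdb hb0 hh hsumD hdiag (fun m => ⟨hadj1 m, hadj2 m⟩) hfar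
    hsmall hbdry m₁ n
  simpa only [hd, hb] using hmain

end Summit.AtomisticToContinuum.Crystallization.Theorems.PeriodicWindowsDenseLaminarHull

end
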